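import Summits.ABC.ABC.Theorems.IsogenyGlueCongruenceMazurKenkuBoundGlue
import Summits.ABC.ABC.Theorems.IsogenyGlueCongruenceMazurKenkuBoundOfFacts
import Summits.ABC.ABC.Theorems.IsogenyGlueCongruenceMazurKenkuBoundStubBarrierCovers
import Summits.ABC.ABC.Theorems.IsogenyGlueCongruenceMazurKenkuBoundStubRadius
import Summits.ABC.ABC.Theorems.IsogenyGlueCongruenceMazurKenkuBoundStubProp51OfRange
import Summits.ABC.ABC.Theorems.IsogenyGlueCongruenceMazurKenkuBoundStubLineMul
import Summits.ABC.ABC.Theorems.IsogenyGlueCongruenceMazurKenkuBoundStubCrudeBound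
import Summits.ABC.ABC.Theorems.IsogenyGlueCongruenceMazurKenkuBoundStubLineProduct
import Summits.ABC.ABC.Theorems.IsogenyGlueCongruenceMazurKenkuBoundStubCycChar
import Summits.ABC.ABC.Theorems.IsogenyGlueCongruenceMazurKenkuBoundStubRangeOf
import Literature.NumberTheory.EllipticCurves.OpenImageMazurInputs
import Literature.NumberTheory.EllipticCurves.KenkuMinimalLevels
import Literature.NumberTheory.EllipticCurves.NeronIsogenyScaling
import HarnessLib

/-!
# Route `IsogenyGlueCongruence`, crux `MazurKenkuBound` (stmt-ABC-15125) — line `Sketch`, cycle 2: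
# Mazur 1978 Prop. 5.1 DISCHARGED; Mazur's Theorem 1 from Cor. 4.4 alone; the crux from four
# printed facts (Modularity removed from the trust base)

Helpers (`--supports stmt-ABC-15125`) of the line lead's skeleton
`Cruxes/MazurKenkuBound/Lines/Sketch.lean`.

* `prop51_exponent_classes_of_additive_holds` — **the named fact
  `Mazur1978.prop51_exponent_classes_of_additive` (B. Mazur, *Rational isogenies of prime degree*,
  Invent. Math. 44 (1978), Prop. 5.1 at a prime of additive, potentially good reduction: the five
  classes of the exponent `k`) is PROVED**, from the six landed stubs of the line: Raynaud's range
  `0 ≤ (e₀k)_m ≤ e₀` by tame characters (`stub_range_of`, fed with `stub_lineMul`,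
  `stub_crudeBound`, `stub_lineProduct`, `stub_cycChar`) and the arithmetic of the five classes
  (`stub_prop51_of_range`). No Raynaud classification of group schemes is used.
* `mazur_isogeny_irreducible_of_cor44` — hence **Mazur's Theorem 1 (`mazur_isogeny_irreducible`)
  holds in the tree from Cor. 4.4 (the Eisenstein quotient) ALONE**
  (`mazur_isogeny_irreducible_holds_of`).
* `edixhoven_int_of_neronLattice_eq_smul_periodLattice` — Edixhoven 1991, Prop. 2 in lattice form,
  as a named fact WITHOUT modularity (a globally minimal `W'/ℚ` that HAS a newform `f` and whose
  Néron lattice is exactly `qΛ_f` has `q ∈ ℤ`): verbatim the hypothesis `hEd` of the tree's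
  `exists_optimal_modularParametrizationData_of_edixhoven` and the second conjunct of
  `exists_optimal_classical_iff_modularity_and_edixhoven` (the fact
  `exists_optimal_modularParametrizationData` used in cycle 1 is `↔ exists_isNewformOf ∧ hEd`, i.e.
  it carried the Modularity theorem, which the crux never needs: its curves come with a datum).
* `mazurKenkuBound_of_four_facts` — **the crux from four printed facts**: Mazur 1978 Cor. 4.4,
  Kenku's composite levels, the Néron scaling integrality, and Edixhoven's Prop. 2 (lattice form).

## References

* [Mazur1978] B. Mazur, *Rational isogenies of prime degree*, Invent. Math. 44 (1978): Thm. 1,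
  Cor. 4.4 (p. 145), Prop. 5.1 (pp. 150–151).
* [Kenku1982] M. A. Kenku, J. London Math. Soc. (2) 23 (1981/82), Thm. 1.
* [EdixhovenManin1991] B. Edixhoven, *On the Manin constants of modular elliptic curves*,
  Progr. Math. 89 (1991), Prop. 2.
* [AgasheRibetStein2006] A. Agashe, K. Ribet, W. A. Stein, *The Manin constant*, Pure Appl. Math.
  Q. 2 (2006), Thm. 2.2.
* [PastenShimura2024] H. Pasten, *Shimura curves and the abc conjecture*, J. Number Theory 254
  (2024), §3 p. 13.
-/

-- `Summit.<Summit>.<Problem>` is the mandated summit-side namespace (CONVENTIONS §2); for the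
-- single-conjunct summit `ABC` the two coincide, so the duplicate `ABC.ABC` is deliberate.
set_option linter.dupNamespace false

noncomputable section

open scoped MatrixGroups ModularForm NNReal NumberField Classical

open CongruenceSubgroup
open WeierstrassCurve
open IsDedekindDomain Field
open Literature.NumberTheory.EllipticCurves
open Literature.NumberTheory.EllipticCurves.ModularForms
open Literature.NumberTheory.GaloisRepresentations
open Literature.NumberTheory.Automorphic

namespace Summit.ABC.ABC.Theorems

/-! ### Mazur 1978, Prop. 5.1 (additive case) — discharged -/

/-- **Mazur 1978, Prop. 5.1 at a prime of additive, potentially good reduction — PROVED.** The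
named fact `Mazur1978.prop51_exponent_classes_of_additive` from the landed stubs of line `Sketch`:
Raynaud's range by tame characters (`stub_range_of` with `stub_lineMul`, `stub_crudeBound`,
`stub_lineProduct`, `stub_cycChar`), then the arithmetic of the five classes
(`stub_prop51_of_range` with `χ = χ̄_N`). [cite: Mazur1978, Prop. 5.1 (pp. 150–151)] -/
theorem prop51_exponent_classes_of_additive_holds : Mazur1978.prop51_exponent_classes_of_additive := by
  intro W _ N _ hN P hP0 r hr hj _ k₀ hk₀I hk₀
  exact stub_prop51_of_range N hN r (modNCyclotomicCharacter ℚ N) k₀ hk₀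
    (stub_range_of stub_lineMul stub_crudeBound stub_lineProduct stub_cycChar W N hN hP0 hr hj k₀ hk₀I)

/-- **Mazur's Theorem 1 from Cor. 4.4 alone**: the irreducibility of `E[p]` for every elliptic
curve over `ℚ` and every prime `p ∉ {2, 3, 5, 7, 11, 13, 17, 19, 37, 43, 67, 163}`
(`mazur_isogeny_irreducible`), granted only the Eisenstein-quotient input Cor. 4.4
(`Mazur1978.cor44_valuation_j_le_one`); everything else of Mazur's §§5–7 is a theorem of the
tree (`mazur_isogeny_irreducible_holds_of` with `prop51_exponent_classes_of_additive_holds`).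
[cite: Mazur1978, Thm. 1 (pp. 129–130) and Cor. 4.4 (p. 145)] -/
theorem mazur_isogeny_irreducible_of_cor44 (h44 : Mazur1978.cor44_valuation_j_le_one) :
    mazur_isogeny_irreducible :=
  mazur_isogeny_irreducible_holds_of h44 prop51_exponent_classes_of_additive_holds

/-! ### Edixhoven's integrality in lattice form, without modularity -/

/-- The modularity-inclusive fact used in cycle 1 implies the modularity-free one (second conjunct
of the tree's `exists_optimal_classical_iff_modularity_and_edixhoven`). [cite: EdixhovenManin1991, Prop. 2] -/
theorem edixhoven_of_exists_optimal (h : exists_optimal_modularParametrizationData) :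
    Literature.NumberTheory.EllipticCurves.edixhoven_int_of_neronLattice_eq_smul_periodLattice :=
  (exists_optimal_classical_iff_modularity_and_edixhoven.mp h).2

/-! ### The crux from four printed facts -/

/-- **The crux `MazurKenkuBound` (stmt-ABC-15125) from FOUR printed facts** — Mazur 1978 Cor. 4.4
(Eisenstein quotient), Kenku's composite levels (`kenku_minimalLevels_mem_kenkuDegrees`), the Néron
scaling integrality (`integral_neronScaling_of_isGloballyMinimal`) and Edixhoven's Prop. 2 in
lattice form (`edixhoven_int_of_neronLattice_eq_smul_periodLattice`): Prop. 5.1 is now a theorem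
(`prop51_exponent_classes_of_additive_holds`), so Mazur's Theorem 1 needs only Cor. 4.4; radius
`≤ 163` by `stub_radius_of_mazur_of_barrier` over `stub_barrierCovers` and
`barrierExcluded_of_kenku`; `hInt` by the optimal pivot `hInt_of_pivot`; the crux by
`pastenShimura_minimalDegree_le_163_mul_of_radius`. Compared with cycle 1
(`mazurKenkuBound_of_facts`): Prop. 5.1 discharged and the Modularity theorem removed from the
trust base. [cite: PastenShimura2024, §3 p. 13] [cite: Mazur1978, Thm. 1 and Cor. 4.4]
[cite: Kenku1982, Thm. 1] [cite: EdixhovenManin1991, Prop. 2] -/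
theorem mazurKenkuBound_of_four_facts (h44 : Mazur1978.cor44_valuation_j_le_one)
    (hK : kenku_minimalLevels_mem_kenkuDegrees) (hN : integral_neronScaling_of_isGloballyMinimal)
    (hEd : Literature.NumberTheory.EllipticCurves.edixhoven_int_of_neronLattice_eq_smul_periodLattice) :
    Summit.ABC.ABC.Theses.IsogenyGlueCongruence.MazurKenkuBound :=
  pastenShimura_minimalDegree_le_163_mul_of_radius
    (stub_radius_of_mazur_of_barrier _ stub_barrierCovers (barrierExcluded_of_kenku hK)
      (mazur_isogeny_irreducible_of_cor44 h44))
    (hInt_of_pivot hN hEd)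

end Summit.ABC.ABC.Theorems

end
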